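import Literature.MathematicalPhysics.QuantumFieldTheory.Balaban1983to89.AveragingRT

/-!
# `Summit.QuantumFields.Balaban3D.Proofs.FibreSplit` — item F1 of HOME/drafts/p4/FIBRE49.md: the product Haar integral over the fine bonds
# SPLITS over a partition of the bond set («the integral over V_k into two parts: the first … restricted to Z_k = B(Λ_{k+1})ᶜ …, the second
# … over B(Λ_{k+1})», [Balaban1985UV3] p. 268 L8–13) — `∫ F(W) dW = ∫∫ F(join(W_Z, W_B)) dW_B dW_Z` (Fubini over `dU = dU_Z ⊗ dU_B`) —
# lane `pub-balaban3d`, seat p4 (tool for the discharge of the residuals R3D-01/02 at the standard averaging, where `T_k[f](V) =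
# ∫ f(axialParam V W) dW` by `AxialFibre.rnTransport_axial_ae_eq`)

HONEST FRAMING (lane PLAN.md §0, binding): see `…Proofs.SectAFirstStep`.  [folklore] product measure theory (Mathlib
`measurePreserving_piEquivPiSubtypeProd`, `integral_prod`); nothing of the paper is asserted.

WHAT THIS FILE PROVES (no `sorry`, axioms standard): `splitEquiv` (the measurable equivalence `(PBond → G) ≃ (Z-bonds → G) × (B-bonds → G)`
for a decidable predicate `B` on bonds), `measurePreserving_split` (`dU ↦ dU_Z ⊗ dU_B`), **`integral_fieldMeasure_split`** (Fubini: the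
field integral of an integrable `F` as an iterated integral, outer over the bonds OUTSIDE `B`, inner over the bonds IN `B`).
-/

noncomputable section

namespace Summit.QuantumFields.Balaban3D.Proofs.FibreSplit

open _root_.MeasureTheory
open Literature.MathematicalPhysics.QuantumFieldTheory.Balaban1983to89

variable {P : Params} {j : ℕ} {G : Type*} [GaugeGroup G] [MeasurableSpace G] [HaarData G]
  (B : PBond P j → Prop) [DecidablePred B]

/-- The bonds OUTSIDE `B` (print's `Z_k`-part) and INSIDE `B` (print's `B(Λ_{k+1})`-part) as a measurable splitting of the field:
`W ↦ (W↾{¬B}, W↾{B})` — Mathlib `MeasurableEquiv.piEquivPiSubtypeProd` with the predicate `¬B` first. [folklore] -/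
def splitEquiv : GaugeField P j G ≃ᵐ ({b : PBond P j // ¬ B b} → G) × ({b : PBond P j // ¬¬ B b} → G) :=
  MeasurableEquiv.piEquivPiSubtypeProd (fun _ : PBond P j => G) (fun b => ¬ B b)

/-- **`dU = dU_Z ⊗ dU_B`**: the splitting pushes product Haar on all bonds to the product of product Haar on the two parts. [folklore] -/
theorem measurePreserving_split :
    MeasurePreserving (splitEquiv B (P := P) (G := G)) (fieldMeasure P j G)
      ((Measure.pi fun _ : {b : PBond P j // ¬ B b} => (HaarData.haar : Measure G)).prod
        (Measure.pi fun _ : {b : PBond P j // ¬¬ B b} => (HaarData.haar : Measure G))) := by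
  unfold fieldMeasure splitEquiv
  exact measurePreserving_piEquivPiSubtypeProd (fun _ : PBond P j => (HaarData.haar : Measure G)) (fun b => ¬ B b)

/-- **FUBINI SPLIT OF THE FIELD INTEGRAL** (p. 268 L8–13 «We decompose the integral over V_k into two parts …»): for `F` integrable on the
fine fields, `∫ F(W) dW = ∫ (∫ F(join(W_Z, W_B)) dW_B) dW_Z`, `join = splitEquiv⁻¹`, outer integral over the bonds outside `B`, inner over
the bonds in `B`. [cite: Balaban1985UV3, (48)–(49) p.268] -/
theorem integral_fieldMeasure_split {E : Type*} [NormedAddCommGroup E] [NormedSpace ℝ E]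
    (F : GaugeField P j G → E) (hF : Integrable F (fieldMeasure P j G)) :
    ∫ W, F W ∂(fieldMeasure P j G) =
      ∫ wZ, ∫ wB, F ((splitEquiv B).symm (wZ, wB))
        ∂(Measure.pi fun _ : {b : PBond P j // ¬¬ B b} => (HaarData.haar : Measure G))
        ∂(Measure.pi fun _ : {b : PBond P j // ¬ B b} => (HaarData.haar : Measure G)) := by
  have hmp := measurePreserving_split B (P := P) (G := G)
  have hsymm := hmp.symm (splitEquiv B (P := P) (G := G))
  -- pull the integral back along the (inverse) splitting, then Fubini
  rw [← hsymm.integral_comp' F]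
  have hint : Integrable (fun z => F ((splitEquiv B (P := P) (G := G)).symm z))
      ((Measure.pi fun _ : {b : PBond P j // ¬ B b} => (HaarData.haar : Measure G)).prod
        (Measure.pi fun _ : {b : PBond P j // ¬¬ B b} => (HaarData.haar : Measure G))) :=
    (hsymm.integrable_comp hF.aestronglyMeasurable).mpr hF
  exact integral_prod _ hint

end Summit.QuantumFields.Balaban3D.Proofs.FibreSplit

end
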